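import Mathlib
import Literature.NumberTheory.Sieve.Maynard2016Lemma8FReduction
import HarnessLib

/-!
# Maynard 2016, Lemma 8: sieve data from bumps (the class (5.3)–(5.5) realised by primitives)

Topic `Literature/NumberTheory/Sieve`. J. Maynard, *Large gaps between primes*, Ann. of Math. (2)
183 (2016), 915–933 = arXiv:1408.5110, §5 (displays (5.3)–(5.5)) and §8 (proof of Lemma 8, the
approximation step: "the set of non-negative linear combinations of direct products of smooth
compactly supported functions [...] is `L²` dense").

The function `F = Σ_j c_j ∏_ℓ F'_{ℓ,j}(t_ℓ)` of (5.5) is built from DERIVATIVES of the smooth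
non-negative `F_{ℓ,j}`. This file fixes the (evident) way such data arise from bumps and proves the
bookkeeping once and for all: given smooth non-negative bumps `φ_{ℓ,j}` vanishing on `[w_{ℓ,j}, ∞)`
with `Σ_ℓ w_{ℓ,j} ≤ 1/10` (`IsBumpData`), the primitives `F_{ℓ,j}(u) = ∫_u^{w_{ℓ,j}} φ_{ℓ,j}`
(`primData`) are smooth data of the class `IsSieveDataF` (`isSieveDataF_primData`), and
`F = (−1)^k Σ_j c_j ∏_ℓ φ_{ℓ,j}(t_ℓ)` (`Fsum_primData`), so that
`I^{(1)}(F) = ∫_{t ≥ 0} (Σ_j c_j ∏_ℓ φ_{ℓ,j}(t_ℓ))²` and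
`J^{(1),i}(F) = ∫ (∫_{u ≥ 0} Σ_j c_j ∏_ℓ φ_{ℓ,j}((t; t_i := u)_ℓ) du)²` (`I1_primData`, `J1_primData`).

The smoothed cell indicators needed for the histogram approximation are provided as `cellBump a b δ`
(smooth, values in `[0,1]`, `= 0` off `(a,b)`, `= 1` on `[a+δ, b−δ]`, `> 0` on `(a,b)`, and
`|cellBump − 1_{[a,b]}| ≤ 1_{ramps}`).

Consequently the approximation fact `Lemma8Density` (`Maynard2016Lemma8FReduction`) follows from
its bump form `BumpDensity` — non-negative combinations of products of bumps `ε`-approximate the two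
functionals of `t ↦ F(10t)` — with no derivatives or primitives left in the statement:
`lemma8Density_of_bumpDensity`, hence `theorem1_of_lemma7_bumpDensity`.

## References

* J. Maynard, *Large gaps between primes*, Ann. of Math. (2) 183 (2016), 915–933; arXiv:1408.5110,
  §5 displays (5.3)–(5.5), Lemma 8 (proof). [Maynard2016LargeGaps]
-/

open Filter Finset MeasureTheory Set
open scoped Topology ContDiff

namespace Literature.NumberTheory.Sieve

namespace Maynard2016

/-! ### One-dimensional primitives of bumps -/

/-- `P(u) = ∫_u^W φ(v) dv`, the primitive used for `F_{ℓ,j}`. [cite: Maynard2016LargeGaps, §5 display (5.3)] -/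
noncomputable def bumpPrim (φ : ℝ → ℝ) (W : ℝ) (u : ℝ) : ℝ :=
  ∫ v in u..W, φ v

/-- `P = −∫_W^·φ`. [cite: Maynard2016LargeGaps, §5 display (5.3)] -/
theorem bumpPrim_eq (φ : ℝ → ℝ) (W : ℝ) : bumpPrim φ W = fun u => -∫ v in W..u, φ v :=
  funext fun _ => intervalIntegral.integral_symm _ _

/-- `P' = −φ`. [cite: Maynard2016LargeGaps, §5 display (5.5)] -/
theorem hasDerivAt_bumpPrim {φ : ℝ → ℝ} (hφ : Continuous φ) (W u : ℝ) :
    HasDerivAt (bumpPrim φ W) (-φ u) u := by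
  rw [bumpPrim_eq]
  exact (hφ.integral_hasStrictDerivAt W u).hasDerivAt.neg

/-- `P' = −φ`. [cite: Maynard2016LargeGaps, §5 display (5.5)] -/
theorem deriv_bumpPrim {φ : ℝ → ℝ} (hφ : Continuous φ) (W u : ℝ) :
    deriv (bumpPrim φ W) u = -φ u :=
  (hasDerivAt_bumpPrim hφ W u).deriv

/-- `P` is differentiable. [cite: Maynard2016LargeGaps, §5 display (5.3)] -/
theorem differentiable_bumpPrim {φ : ℝ → ℝ} (hφ : Continuous φ) (W : ℝ) :
    Differentiable ℝ (bumpPrim φ W) :=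
  fun u => (hasDerivAt_bumpPrim hφ W u).differentiableAt

/-- `P` is smooth when `φ` is. [cite: Maynard2016LargeGaps, §5 display (5.3)] -/
theorem contDiff_bumpPrim {φ : ℝ → ℝ} (hφ : ContDiff ℝ ∞ φ) (W : ℝ) :
    ContDiff ℝ ∞ (bumpPrim φ W) := by
  refine contDiff_infty_iff_deriv.2 ⟨differentiable_bumpPrim hφ.continuous W, ?_⟩
  have : deriv (bumpPrim φ W) = fun u => -φ u := funext (deriv_bumpPrim hφ.continuous W)
  rw [this]
  exact hφ.neg

/-- `P(u) = 0` for `u ≥ W` when `φ` vanishes on `[W, ∞)`. [cite: Maynard2016LargeGaps, §5 display (5.4)] -/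
theorem bumpPrim_of_le {φ : ℝ → ℝ} {W : ℝ} (hφW : ∀ v, W ≤ v → φ v = 0) {u : ℝ} (hu : W ≤ u) :
    bumpPrim φ W u = 0 := by
  rw [bumpPrim_eq]
  simp only [neg_eq_zero]
  rw [intervalIntegral.integral_congr (g := fun _ => (0 : ℝ)) ?_, intervalIntegral.integral_zero]
  intro v hv
  rw [Set.uIcc_of_le hu] at hv
  exact hφW v hv.1

/-- `P ≥ 0` for `φ ≥ 0` vanishing on `[W, ∞)`. [cite: Maynard2016LargeGaps, §5 display (5.3)] -/
theorem bumpPrim_nonneg {φ : ℝ → ℝ} {W : ℝ} (h0 : ∀ v, 0 ≤ φ v) (hφW : ∀ v, W ≤ v → φ v = 0)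
    (u : ℝ) : 0 ≤ bumpPrim φ W u := by
  rcases le_total u W with hu | hu
  · exact intervalIntegral.integral_nonneg hu fun v _ => h0 v
  · rw [bumpPrim_of_le hφW hu]

/-- `P(u) ≠ 0 ⇒ u < W`. [cite: Maynard2016LargeGaps, §5 display (5.4)] -/
theorem lt_of_bumpPrim_ne_zero {φ : ℝ → ℝ} {W : ℝ} (hφW : ∀ v, W ≤ v → φ v = 0) {u : ℝ}
    (hu : bumpPrim φ W u ≠ 0) : u < W := by
  by_contra h
  exact hu (bumpPrim_of_le hφW (not_lt.1 h))

/-- `P(u₀) > 0` at a point where `φ(u₀) > 0` (`φ ≥ 0` continuous). [cite: Maynard2016LargeGaps, §5 display (5.3)] -/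
theorem bumpPrim_pos {φ : ℝ → ℝ} {W : ℝ} (hφ : Continuous φ) (h0 : ∀ v, 0 ≤ φ v)
    (hφW : ∀ v, W ≤ v → φ v = 0) {u₀ : ℝ} (hu₀ : 0 < φ u₀) : 0 < bumpPrim φ W u₀ := by
  have hW : u₀ < W := by
    by_contra h
    exact hu₀.ne' (hφW u₀ (not_lt.1 h))
  have h := intervalIntegral.integral_lt_integral_of_continuousOn_of_le_of_exists_lt hW
    (continuousOn_const (c := (0 : ℝ))) hφ.continuousOn (fun v _ => h0 v)
    ⟨u₀, Set.left_mem_Icc.2 hW.le, hu₀⟩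
  simpa only [bumpPrim, intervalIntegral.integral_zero] using h

/-! ### Bump data and the induced sieve data -/

/-- **Bump data**: smooth non-negative bumps `φ_{ℓ,j}` vanishing on `[w_{ℓ,j}, ∞)`, positive
somewhere on `[0, ∞)`, with `Σ_ℓ w_{ℓ,j} ≤ 1/10` for every `j` (so that the primitives satisfy
(5.4)). [cite: Maynard2016LargeGaps, §5 displays (5.3)–(5.4)] -/
structure IsBumpData (k J : ℕ) (w : Fin k → Fin J → ℝ) (φ : Fin k → Fin J → ℝ → ℝ) : Prop where
  /-- each `φ_{ℓ,j}` is smooth. -/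
  smooth : ∀ ℓ j, ContDiff ℝ ∞ (φ ℓ j)
  /-- each `φ_{ℓ,j}` is non-negative. -/
  nonneg : ∀ ℓ j v, 0 ≤ φ ℓ j v
  /-- `φ_{ℓ,j}` vanishes on `[w_{ℓ,j}, ∞)`. -/
  eq_zero_of_le : ∀ ℓ j v, w ℓ j ≤ v → φ ℓ j v = 0
  /-- `φ_{ℓ,j}` is positive somewhere on `[0, ∞)`. -/
  exists_pos : ∀ ℓ j, ∃ v, 0 ≤ v ∧ 0 < φ ℓ j v
  /-- the box condition `Σ_ℓ w_{ℓ,j} ≤ 1/10`. -/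
  sum_le : ∀ j, ∑ ℓ, w ℓ j ≤ 1 / 10

/-- The primitives `F_{ℓ,j}(u) = ∫_u^{w_{ℓ,j}} φ_{ℓ,j}`. [cite: Maynard2016LargeGaps, §5 display (5.3)] -/
noncomputable def primData {k J : ℕ} (w : Fin k → Fin J → ℝ) (φ : Fin k → Fin J → ℝ → ℝ) :
    Fin k → Fin J → ℝ → ℝ :=
  fun ℓ j => bumpPrim (φ ℓ j) (w ℓ j)

/-- `Σ_j c_j ∏_ℓ φ_{ℓ,j}(t_ℓ)`. [cite: Maynard2016LargeGaps, §5 display (5.5)] -/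
noncomputable def bumpSum {k J : ℕ} (c : Fin J → ℝ) (φ : Fin k → Fin J → ℝ → ℝ)
    (t : Fin k → ℝ) : ℝ :=
  ∑ j, c j * ∏ ℓ, φ ℓ j (t ℓ)

/-- **Bump data give sieve data of the class (5.3)–(5.5).** [cite: Maynard2016LargeGaps, §5 displays (5.3)–(5.4)] -/
theorem isSieveDataF_primData {k J : ℕ} {c : Fin J → ℝ} {w : Fin k → Fin J → ℝ}
    {φ : Fin k → Fin J → ℝ → ℝ} (hc : ∀ j, 0 < c j) (h : IsBumpData k J w φ) :
    IsSieveDataF k J c (primData w φ) where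
  c_pos := hc
  Fd_smooth ℓ j := contDiff_bumpPrim (h.smooth ℓ j) _
  Fd_nonneg ℓ j u := bumpPrim_nonneg (h.nonneg ℓ j) (h.eq_zero_of_le ℓ j) u
  Fd_ne_zero ℓ j := by
    obtain ⟨v, hv0, hv⟩ := h.exists_pos ℓ j
    exact ⟨v, hv0, (bumpPrim_pos (h.smooth ℓ j).continuous (h.nonneg ℓ j)
      (h.eq_zero_of_le ℓ j) hv).ne'⟩
  Fd_support j u _ hne := by
    have hlt : ∀ ℓ, u ℓ < w ℓ j := fun ℓ => lt_of_bumpPrim_ne_zero (h.eq_zero_of_le ℓ j) (hne ℓ)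
    exact (Finset.sum_le_sum fun ℓ _ => (hlt ℓ).le).trans (h.sum_le j)

/-- `∏_ℓ (−f_ℓ) = (−1)^k ∏_ℓ f_ℓ`. [folklore] -/
private theorem prod_neg_eq {k : ℕ} (f : Fin k → ℝ) : ∏ ℓ, -f ℓ = (-1) ^ k * ∏ ℓ, f ℓ := by
  have : (fun ℓ => -f ℓ) = fun ℓ => (-1) * f ℓ := funext fun ℓ => (neg_one_mul _).symm
  rw [this, Finset.prod_mul_distrib, Finset.prod_const, Finset.card_univ, Fintype.card_fin]

/-- `((−1)^k x)² = x²`. [folklore] -/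
private theorem neg_one_pow_mul_sq {k : ℕ} (x : ℝ) : ((-1) ^ k * x) ^ 2 = x ^ 2 := by
  rw [mul_pow, ← pow_mul, mul_comm k 2, pow_mul, neg_one_sq, one_pow, one_mul]

/-- **`F = (−1)^k Σ_j c_j ∏_ℓ φ_{ℓ,j}(t_ℓ)`** for the data induced by bumps. [cite: Maynard2016LargeGaps, §5 display (5.5)] -/
theorem Fsum_primData {k J : ℕ} (c : Fin J → ℝ) {w : Fin k → Fin J → ℝ}
    {φ : Fin k → Fin J → ℝ → ℝ} (hφ : ∀ ℓ j, Continuous (φ ℓ j)) (t : Fin k → ℝ) :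
    Fsum c (primData w φ) t = (-1) ^ k * bumpSum c φ t := by
  unfold Fsum bumpSum primData
  simp_rw [deriv_bumpPrim (hφ _ _)]
  rw [Finset.mul_sum]
  refine Finset.sum_congr rfl fun j _ => ?_
  rw [prod_neg_eq]
  ring

/-- `I^{(1)}` of the induced data. [cite: Maynard2016LargeGaps, Lemma 6 (definition of I^(1))] -/
theorem I1_primData {k J : ℕ} (c : Fin J → ℝ) {w : Fin k → Fin J → ℝ}
    {φ : Fin k → Fin J → ℝ → ℝ} (hφ : ∀ ℓ j, Continuous (φ ℓ j)) :
    I1 c (primData w φ) = ∫ t in Set.univ.pi (fun _ : Fin k => Set.Ici (0 : ℝ)), bumpSum c φ t ^ 2 := by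
  unfold I1
  simp_rw [Fsum_primData c hφ, neg_one_pow_mul_sq]

/-- `J^{(1),i}` of the induced data. [cite: Maynard2016LargeGaps, Lemma 7 (definition of J^(1))] -/
theorem J1_primData {k J : ℕ} (c : Fin J → ℝ) {w : Fin k → Fin J → ℝ}
    {φ : Fin k → Fin J → ℝ → ℝ} (hφ : ∀ ℓ j, Continuous (φ ℓ j)) (i : Fin k) :
    J1 c (primData w φ) i =
      ∫ t in Set.univ.pi (fun ℓ : Fin k => if ℓ = i then Set.Icc (0 : ℝ) 1 else Set.Ici 0),
        (∫ u in Set.Ioi (0 : ℝ), bumpSum c φ (Function.update t i u)) ^ 2 := by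
  unfold J1
  simp_rw [Fsum_primData c hφ, integral_const_mul, neg_one_pow_mul_sq]

/-! ### Smooth plateau bumps on a cell `[a, b]` (the smoothed cell indicators) -/

/-- The smooth plateau bump `β_{a,b,δ}(u) = S((u − a)/δ) S((b − u)/δ)` (`S` = `Real.smoothTransition`):
smooth, with values in `[0, 1]`, `= 0` off `(a, b)`, `= 1` on `[a + δ, b − δ]`, `> 0` on `(a, b)`.
[cite: Maynard2016LargeGaps, Lemma 8 (proof, "smooth compactly supported functions")] -/
noncomputable def cellBump (a b δ : ℝ) (u : ℝ) : ℝ :=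
  Real.smoothTransition ((u - a) / δ) * Real.smoothTransition ((b - u) / δ)

/-- `β` is smooth. [cite: Maynard2016LargeGaps, Lemma 8 (proof)] -/
theorem cellBump_contDiff (a b δ : ℝ) : ContDiff ℝ ∞ (cellBump a b δ) := by
  unfold cellBump
  exact (Real.smoothTransition.contDiff.comp ((contDiff_id.sub contDiff_const).div_const δ)).mul
    (Real.smoothTransition.contDiff.comp ((contDiff_const.sub contDiff_id).div_const δ))

/-- `β ≥ 0`. [cite: Maynard2016LargeGaps, Lemma 8 (proof)] -/
theorem cellBump_nonneg (a b δ u : ℝ) : 0 ≤ cellBump a b δ u :=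
  mul_nonneg (Real.smoothTransition.nonneg _) (Real.smoothTransition.nonneg _)

/-- `β ≤ 1`. [cite: Maynard2016LargeGaps, Lemma 8 (proof)] -/
theorem cellBump_le_one (a b δ u : ℝ) : cellBump a b δ u ≤ 1 :=
  mul_le_one₀ (Real.smoothTransition.le_one _) (Real.smoothTransition.nonneg _)
    (Real.smoothTransition.le_one _)

/-- `β(u) = 0` for `u ≤ a` (`δ > 0`). [cite: Maynard2016LargeGaps, Lemma 8 (proof)] -/
theorem cellBump_of_le_left {a b δ u : ℝ} (hδ : 0 < δ) (hu : u ≤ a) : cellBump a b δ u = 0 := by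
  unfold cellBump
  rw [Real.smoothTransition.zero_of_nonpos (div_nonpos_of_nonpos_of_nonneg (by linarith) hδ.le),
    zero_mul]

/-- `β(u) = 0` for `u ≥ b` (`δ > 0`). [cite: Maynard2016LargeGaps, Lemma 8 (proof)] -/
theorem cellBump_of_ge_right {a b δ u : ℝ} (hδ : 0 < δ) (hu : b ≤ u) : cellBump a b δ u = 0 := by
  unfold cellBump
  rw [Real.smoothTransition.zero_of_nonpos (x := (b - u) / δ)
    (div_nonpos_of_nonpos_of_nonneg (by linarith) hδ.le), mul_zero]

/-- `β(u) = 1` for `a + δ ≤ u ≤ b − δ` (`δ > 0`). [cite: Maynard2016LargeGaps, Lemma 8 (proof)] -/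
theorem cellBump_eq_one {a b δ u : ℝ} (hδ : 0 < δ) (h1 : a + δ ≤ u) (h2 : u ≤ b - δ) :
    cellBump a b δ u = 1 := by
  unfold cellBump
  rw [Real.smoothTransition.one_of_one_le ((one_le_div hδ).2 (by linarith)),
    Real.smoothTransition.one_of_one_le ((one_le_div hδ).2 (by linarith)), one_mul]

/-- `β(u) > 0` for `a < u < b` (`δ > 0`). [cite: Maynard2016LargeGaps, Lemma 8 (proof)] -/
theorem cellBump_pos {a b δ u : ℝ} (hδ : 0 < δ) (ha : a < u) (hb : u < b) : 0 < cellBump a b δ u :=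
  mul_pos (Real.smoothTransition.pos_of_pos (div_pos (by linarith) hδ))
    (Real.smoothTransition.pos_of_pos (div_pos (by linarith) hδ))

/-- `|β − 1_{[a,b]}| ≤ 1_{[a, a+δ] ∪ [b−δ, b]}` pointwise (`δ > 0`): the smoothed indicator differs
from the cell indicator only on the two ramps, by at most `1`. [cite: Maynard2016LargeGaps, Lemma 8 (proof)] -/
theorem abs_cellBump_sub_indicator_le {a b δ : ℝ} (hδ : 0 < δ) (u : ℝ) :
    |cellBump a b δ u - (Set.Icc a b).indicator (fun _ => (1 : ℝ)) u| ≤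
      (Set.Icc a (a + δ) ∪ Set.Icc (b - δ) b).indicator (fun _ => (1 : ℝ)) u := by
  by_cases hr : u ∈ Set.Icc a (a + δ) ∪ Set.Icc (b - δ) b
  · rw [Set.indicator_of_mem hr]
    by_cases hab : u ∈ Set.Icc a b
    · rw [Set.indicator_of_mem hab, abs_le]
      exact ⟨by linarith [cellBump_nonneg a b δ u], by linarith [cellBump_le_one a b δ u]⟩
    · rw [Set.indicator_of_notMem hab, sub_zero, abs_of_nonneg (cellBump_nonneg a b δ u)]
      exact cellBump_le_one a b δ u
  · rw [Set.indicator_of_notMem hr]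
    simp only [Set.mem_union, Set.mem_Icc, not_or, not_and_or, not_le] at hr
    obtain ⟨h1, h2⟩ := hr
    by_cases hab : u ∈ Set.Icc a b
    · rw [Set.indicator_of_mem hab]
      obtain ⟨hau, hub⟩ := hab
      have h1' : a + δ < u := by rcases h1 with h1 | h1 <;> [linarith; exact h1]
      have h2' : u < b - δ := by rcases h2 with h2 | h2 <;> [exact h2; linarith]
      rw [cellBump_eq_one hδ h1'.le h2'.le, sub_self, abs_zero]
    · rw [Set.indicator_of_notMem hab, sub_zero]
      simp only [Set.mem_Icc, not_and_or, not_le] at hab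
      rcases hab with hab | hab
      · rw [cellBump_of_le_left hδ hab.le, abs_zero]
      · rw [cellBump_of_ge_right hδ hab.le, abs_zero]

/-! ### The approximation step in bump form -/

/-- **Maynard 2016, Lemma 8, approximation step (bump form)**: for every non-negative admissible
`F` on the unit simplex `R_k` and every `ε > 0` there are `J`, `c_j > 0` and bump data
`(w_{ℓ,j}, φ_{ℓ,j})` (`IsBumpData`) such that the two functionals of `Σ_j c_j ∏_ℓ φ_{ℓ,j}(t_ℓ)`
are within `ε` of those of `t ↦ F(10t)`, namely `10^{−k} I_k(F)` and `10^{−k−1} J_k^{(i)}(F)`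
("`F` is a smooth approximation to `F_k(10t)` [...] since the set of non-negative linear
combinations of direct products of smooth compactly supported functions is `L²` dense"). Named
fact, not proved here (grid histograms of `F(10t)·1_{Σ t ≤ 1/10 − η}`, smoothed cell indicators,
the substitution `t ↦ 10t`, and the `L²`-continuity of the two functionals). [cite: Maynard2016LargeGaps, Lemma 8 (proof, approximation step)] -/
def BumpDensity : Prop :=
  ∀ k : ℕ, 1 ≤ k → ∀ F : (Fin k → ℝ) → ℝ, IsMaynardAdmissible k F → (∀ t, 0 ≤ F t) →
    ∀ ε : ℝ, 0 < ε →
      ∃ (J : ℕ) (c : Fin J → ℝ) (w : Fin k → Fin J → ℝ) (φ : Fin k → Fin J → ℝ → ℝ),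
        (∀ j, 0 < c j) ∧ IsBumpData k J w φ ∧
          |(∫ t in Set.univ.pi (fun _ : Fin k => Set.Ici (0 : ℝ)), bumpSum c φ t ^ 2) -
              maynardI k F / 10 ^ k| ≤ ε ∧
            ∀ i, |(∫ t in Set.univ.pi (fun ℓ : Fin k => if ℓ = i then Set.Icc (0 : ℝ) 1
                  else Set.Ici 0),
                (∫ u in Set.Ioi (0 : ℝ), bumpSum c φ (Function.update t i u)) ^ 2) -
              maynardJ k i F / 10 ^ (k + 1)| ≤ ε

/-- **`Lemma8Density` from its bump form, PROVED.** [cite: Maynard2016LargeGaps, Lemma 8 (proof, approximation step)] -/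
theorem lemma8Density_of_bumpDensity (hB : BumpDensity) : Lemma8Density := by
  intro k hk F hF hF0 ε hε
  obtain ⟨J, c, w, φ, hc, hφ, hI, hJ⟩ := hB k hk F hF hF0 ε hε
  have hcont : ∀ ℓ j, Continuous (φ ℓ j) := fun ℓ j => (hφ.smooth ℓ j).continuous
  refine ⟨J, c, primData w φ, isSieveDataF_primData hc hφ, ?_, fun i => ?_⟩
  · rwa [I1_primData c hcont]
  · rw [J1_primData c hcont]
    exact hJ i

/-- `Lemma8F` from the bump form. [cite: Maynard2016LargeGaps, Lemma 8 (proof)] -/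
theorem lemma8F_of_bumpDensity (hB : BumpDensity) : Lemma8F :=
  lemma8F_of_density (lemma8Density_of_bumpDensity hB)

/-- `GPYMeasures` from `Lemma7` and the bump form. [cite: Maynard2016LargeGaps, §8 (final paragraph)] -/
theorem gpyMeasures_of_lemma7_bumpDensity (h7 : Lemma7) (hB : BumpDensity) : GPYMeasures :=
  gpyMeasures_of_lemma7_density h7 (lemma8Density_of_bumpDensity hB)

/-- **Maynard's Theorem 1 from `Lemma7` and `BumpDensity`.** [cite: Maynard2016LargeGaps, Theorem 1] -/
theorem theorem1_of_lemma7_bumpDensity (h7 : Lemma7) (hB : BumpDensity) :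
    Literature.NumberTheory.Sieve.Maynard2016_theorem1 :=
  theorem1_of_lemma7_density h7 (lemma8Density_of_bumpDensity hB)

/-- **`∀ c, RankinConstant c` from `Lemma7` and `BumpDensity`.** [cite: Maynard2016LargeGaps, Theorem 1] -/
theorem forall_rankinConstant_of_lemma7_bumpDensity (h7 : Lemma7) (hB : BumpDensity) (c : ℝ) :
    Literature.NumberTheory.Sieve.RankinConstant c :=
  forall_rankinConstant_of_lemma7_density h7 (lemma8Density_of_bumpDensity hB) c

end Maynard2016

end Literature.NumberTheory.Sieve
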